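import Mathlib
import Literature.Barriers.QuantumFields.WilsonDeterminantSign
import Literature.MathematicalPhysics.QuantumFieldTheory.QCDPhaseQuenchedTranslation
import Literature.MathematicalPhysics.QuantumFieldTheory.QCDWickMinorMeasurability
import Literature.MathematicalPhysics.QuantumFieldTheory.QCDHeavyQuarkPropagator

/-!
# Spectral reduction of the `r = 1` slice of the open core of crux stmt-QuantumFields-9151
(`PauliWegnerSea.PhaseQuenchedFlavourDecay`, line `crossing-split-integrability`, lead c3)

For a Hermitian matrix `A` with eigenvalues `λ_t`, every family of entries of `A⁻¹` indexed injectively in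
both slots obeys `Σ_x ‖A⁻¹ (ρ x) (κ x)‖^q ≤ Σ_t |λ_t|^{-q}` (`q ≥ 1`; AM–GM on the eigenvector weights,
Jensen, unit column norms).  Applied to `Γ₅ D_W` (same entry norms as `D_W⁻¹ = (Γ₅ D_W)⁻¹ Γ₅`) and to the
torus translates of one entry, under the translation-invariant phase-quenched measure, it bounds
`#sites · ⟨‖G_f((0,c),(w,c'))‖^q⟩₊` by the phase-quenched inverse spectral moment `⟨Σ_t |λ_t|^{-q}⟩₊`: the
`r = 1` case of `MinorMoments` follows from a bound on the `|det|`-tilted density of states alone.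
-/

noncomputable section
namespace Summit.QuantumFields.QCD.Cruxes.PhaseQuenchedFlavourDecay.CrossingSplitIntegrability

open scoped BigOperators ComplexConjugate
open MeasureTheory Filter Matrix
open Literature.MathematicalPhysics.QuantumFieldTheory Literature.MathematicalPhysics.QuantumLattice
  Literature.Probability.LatticeModels

section SpectralDomination

variable {n : Type*} [Fintype n] [DecidableEq n]

/-- Rows of a unitary matrix have unit Euclidean norm: `Σ_t ‖U p t‖² = 1`. -/
theorem sum_norm_sq_row_eq_one {U : Matrix n n ℂ} (hU : U ∈ Matrix.unitaryGroup n ℂ) (p : n) :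
    ∑ t, ‖U p t‖ ^ 2 = 1 := by
  have h : (U * star U) p p = 1 := by
    rw [Matrix.mem_unitaryGroup_iff.1 hU, Matrix.one_apply_eq]
  rw [Matrix.mul_apply] at h
  have h' : ∀ t, U p t * (star U) t p = ((‖U p t‖ ^ 2 : ℝ) : ℂ) := fun t => by
    rw [Matrix.star_apply, Complex.star_def, Complex.mul_conj, Complex.normSq_eq_norm_sq]
  simp_rw [h'] at h
  rw [← Complex.ofReal_sum] at h
  exact_mod_cast h

/-- Columns of a unitary matrix have unit Euclidean norm: `Σ_p ‖U p t‖² = 1`. -/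
theorem sum_norm_sq_col_eq_one {U : Matrix n n ℂ} (hU : U ∈ Matrix.unitaryGroup n ℂ) (t : n) :
    ∑ p, ‖U p t‖ ^ 2 = 1 := by
  have h : (star U * U) t t = 1 := by
    rw [Matrix.mem_unitaryGroup_iff'.1 hU, Matrix.one_apply_eq]
  rw [Matrix.mul_apply] at h
  have h' : ∀ p, (star U) t p * U p t = ((‖U p t‖ ^ 2 : ℝ) : ℂ) := fun p => by
    rw [Matrix.star_apply, Complex.star_def, mul_comm, Complex.mul_conj, Complex.normSq_eq_norm_sq]
  simp_rw [h'] at h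
  rw [← Complex.ofReal_sum] at h
  exact_mod_cast h

/-- **Spectral form of the inverse of a Hermitian matrix**: if `det A ≠ 0` then
`A⁻¹ = U · diag(λ⁻¹) · Uᴴ` with `U` the eigenvector unitary and `λ` the (real, non-zero) eigenvalues. -/
theorem inv_eq_eigenvectorUnitary_mul_diagonal {A : Matrix n n ℂ} (hA : A.IsHermitian) (hdet : A.det ≠ 0) :
    A⁻¹ = (hA.eigenvectorUnitary : Matrix n n ℂ) *
      diagonal (fun t => ((hA.eigenvalues t : ℂ))⁻¹) * star (hA.eigenvectorUnitary : Matrix n n ℂ) := by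
  set U : Matrix n n ℂ := (hA.eigenvectorUnitary : Matrix n n ℂ) with hUdef
  have hne : ∀ t, (hA.eigenvalues t : ℂ) ≠ 0 := by
    intro t ht
    apply hdet
    rw [hA.det_eq_prod_eigenvalues]
    exact Finset.prod_eq_zero (Finset.mem_univ t) ht
  have hUU : star U * U = 1 := Unitary.coe_star_mul_self hA.eigenvectorUnitary
  have hspec : A = U * diagonal (fun t => (hA.eigenvalues t : ℂ)) * star U := by
    conv_lhs => rw [hA.spectral_theorem]
    rw [Unitary.conjStarAlgAut_apply]
    rfl
  refine Matrix.inv_eq_right_inv ?_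
  calc A * (U * diagonal (fun t => ((hA.eigenvalues t : ℂ))⁻¹) * star U)
      = U * diagonal (fun t => (hA.eigenvalues t : ℂ)) * star U *
        (U * diagonal (fun t => ((hA.eigenvalues t : ℂ))⁻¹) * star U) := by rw [← hspec]
    _ = U * diagonal (fun t => (hA.eigenvalues t : ℂ)) * (star U * U) *
          diagonal (fun t => ((hA.eigenvalues t : ℂ))⁻¹) * star U := by
        simp only [Matrix.mul_assoc]
    _ = U * (diagonal (fun t => (hA.eigenvalues t : ℂ)) * diagonal (fun t => ((hA.eigenvalues t : ℂ))⁻¹)) *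
          star U := by rw [hUU, Matrix.mul_one, Matrix.mul_assoc U]
    _ = U * star U := by
        rw [diagonal_mul_diagonal]
        have : (fun t => (hA.eigenvalues t : ℂ) * ((hA.eigenvalues t : ℂ))⁻¹) = fun _ => 1 :=
          funext fun t => mul_inv_cancel₀ (hne t)
        rw [this, diagonal_one, Matrix.mul_one]
    _ = 1 := Unitary.coe_mul_star_self hA.eigenvectorUnitary

/-- **Entrywise spectral bound**: `‖A⁻¹ p r‖ ≤ Σ_t ‖U p t‖ · ‖U r t‖ · |λ_t|⁻¹` for a Hermitian `A`
(both sides vanish-or-hold trivially when `det A = 0`, where Mathlib's `A⁻¹ = 0`). -/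
theorem norm_inv_apply_le_sum_eigen {A : Matrix n n ℂ} (hA : A.IsHermitian) (p r : n) :
    ‖A⁻¹ p r‖ ≤ ∑ t, ‖(hA.eigenvectorUnitary : Matrix n n ℂ) p t‖ *
      ‖(hA.eigenvectorUnitary : Matrix n n ℂ) r t‖ * |hA.eigenvalues t|⁻¹ := by
  by_cases hdet : A.det = 0
  · rw [Matrix.nonsing_inv_apply_not_isUnit _ (by rw [hdet]; exact not_isUnit_zero), Matrix.zero_apply,
      norm_zero]
    exact Finset.sum_nonneg fun t _ => by positivity
  · rw [inv_eq_eigenvectorUnitary_mul_diagonal hA hdet, Matrix.mul_apply]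
    refine (norm_sum_le _ _).trans (Finset.sum_le_sum fun t _ => ?_)
    rw [mul_diagonal, Matrix.star_apply, norm_mul, norm_mul, norm_star, norm_inv, Complex.norm_real,
      Real.norm_eq_abs]
    ring_nf
    rfl

/-- **Spectral domination of injectively indexed entry families** (the deterministic heart): for Hermitian
`A` with eigenvalues `λ_t`, injective `ρ κ : m → n` and `q ≥ 1`, `Σ_x ‖A⁻¹ (ρ x) (κ x)‖^q ≤ Σ_t |λ_t|^{-q}`
(AM–GM makes the entrywise bound a convex combination, Jensen for `x ↦ x^q`, column sums `≤ 1`). -/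
theorem sum_norm_inv_apply_rpow_le {A : Matrix n n ℂ} (hA : A.IsHermitian) {m : Type*} [Fintype m]
    (ρ κ : m → n) (hρ : Function.Injective ρ) (hκ : Function.Injective κ) {q : ℝ} (hq : 1 ≤ q) :
    ∑ x, ‖A⁻¹ (ρ x) (κ x)‖ ^ q ≤ ∑ t, (|hA.eigenvalues t|⁻¹) ^ q := by
  set U : Matrix n n ℂ := (hA.eigenvectorUnitary : Matrix n n ℂ) with hUdef
  have hUmem : U ∈ Matrix.unitaryGroup n ℂ := hA.eigenvectorUnitary.2
  -- weights `w x t = (‖U (ρ x) t‖² + ‖U (κ x) t‖²)/2`, a probability vector in `t` for each `x`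
  set w : m → n → ℝ := fun x t => (‖U (ρ x) t‖ ^ 2 + ‖U (κ x) t‖ ^ 2) / 2 with hwdef
  have hw0 : ∀ x t, 0 ≤ w x t := fun x t => by positivity
  have hw1 : ∀ x, ∑ t, w x t = 1 := fun x => by
    simp only [hwdef, ← Finset.sum_div, Finset.sum_add_distrib,
      sum_norm_sq_row_eq_one hUmem]
    norm_num
  set c : n → ℝ := fun t => |hA.eigenvalues t|⁻¹ with hcdef
  have hc0 : ∀ t, 0 ≤ c t := fun t => by positivity
  -- entrywise: `‖A⁻¹ (ρ x) (κ x)‖ ≤ Σ_t w x t * c t`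
  have hentry : ∀ x, ‖A⁻¹ (ρ x) (κ x)‖ ≤ ∑ t, w x t * c t := fun x => by
    refine (norm_inv_apply_le_sum_eigen hA (ρ x) (κ x)).trans (Finset.sum_le_sum fun t _ => ?_)
    have h2 : ‖U (ρ x) t‖ * ‖U (κ x) t‖ ≤ w x t := by
      rw [hwdef]
      nlinarith [sq_nonneg (‖U (ρ x) t‖ - ‖U (κ x) t‖)]
    exact mul_le_mul_of_nonneg_right h2 (hc0 t)
  -- Jensen: `(Σ_t w x t * c t)^q ≤ Σ_t w x t * (c t)^q`
  have hjensen : ∀ x, (∑ t, w x t * c t) ^ q ≤ ∑ t, w x t * c t ^ q := fun x => by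
    have h := (convexOn_rpow hq).map_sum_le (t := Finset.univ) (w := w x) (p := c)
      (fun t _ => hw0 x t) (hw1 x) (fun t _ => Set.mem_Ici.2 (hc0 t))
    simpa only [smul_eq_mul] using h
  -- termwise bound and summation over `x`
  have hterm : ∀ x, ‖A⁻¹ (ρ x) (κ x)‖ ^ q ≤ ∑ t, w x t * c t ^ q := fun x =>
    (Real.rpow_le_rpow (norm_nonneg _) (hentry x) (by linarith)).trans (hjensen x)
  calc ∑ x, ‖A⁻¹ (ρ x) (κ x)‖ ^ q ≤ ∑ x, ∑ t, w x t * c t ^ q := Finset.sum_le_sum fun x _ => hterm x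
    _ = ∑ t, (∑ x, w x t) * c t ^ q := by rw [Finset.sum_comm]; simp_rw [Finset.sum_mul]
    _ ≤ ∑ t, 1 * c t ^ q := Finset.sum_le_sum fun t _ =>
        mul_le_mul_of_nonneg_right ?_ (Real.rpow_nonneg (hc0 t) q)
    _ = ∑ t, (|hA.eigenvalues t|⁻¹) ^ q := by simp [hcdef]
  -- column sums of the weights over an injective family are `≤ 1`
  have hcol : ∀ (σ : m → n), Function.Injective σ → ∑ x, ‖U (σ x) t‖ ^ 2 ≤ 1 := fun σ hσ => by
    calc ∑ x, ‖U (σ x) t‖ ^ 2 = ∑ p ∈ Finset.univ.map ⟨σ, hσ⟩, ‖U p t‖ ^ 2 := by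
          rw [Finset.sum_map]; rfl
      _ ≤ ∑ p, ‖U p t‖ ^ 2 :=
          Finset.sum_le_sum_of_subset_of_nonneg (Finset.subset_univ _) fun p _ _ => by positivity
      _ = 1 := sum_norm_sq_col_eq_one hUmem t
  have h1 := hcol ρ hρ
  have h2 := hcol κ hκ
  simp only [hwdef, ← Finset.sum_div, Finset.sum_add_distrib] at h1 h2 ⊢
  linarith

/-- The single-entry case (`m = Unit`): `‖A⁻¹ p r‖^q ≤ Σ_t |λ_t|^{-q}` — the pointwise domination that
transfers integrability. -/
theorem norm_inv_apply_rpow_le {A : Matrix n n ℂ} (hA : A.IsHermitian) (p r : n) {q : ℝ} (hq : 1 ≤ q) :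
    ‖A⁻¹ p r‖ ^ q ≤ ∑ t, (|hA.eigenvalues t|⁻¹) ^ q := by
  have h := sum_norm_inv_apply_rpow_le hA (m := Unit) (fun _ => p) (fun _ => r)
    (fun _ _ _ => rfl) (fun _ _ _ => rfl) hq
  simpa using h

end SpectralDomination

/-! ## The Wilson–Dirac matrix: entry norms of `D_W⁻¹` are spectrally dominated by `Γ₅ D_W` -/

section Wilson

open Literature.Barriers.QuantumFields

variable {L : ℕ} [NeZero L]

/-- The chiral sign `ε_α ∈ {1, 1, -1, -1}` has norm one. -/
theorem norm_gammaFiveSign (α : Fin 4) : ‖(![1, 1, -1, -1] : Fin 4 → ℂ) α‖ = 1 := by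
  fin_cases α <;> simp

/-- **`D_W⁻¹` and `(Γ₅ D_W)⁻¹` have the same entry norms**: `D_W = Γ₅ (Γ₅ D_W)` with `Γ₅² = 1`, so
`D_W⁻¹ = (Γ₅ D_W)⁻¹ Γ₅` and `Γ₅` is a diagonal matrix of signs (this holds verbatim for Mathlib's junk inverse
when `D_W` is singular, since then `Γ₅ D_W` is singular too). -/
theorem norm_inv_wilsonDirac_apply_eq (U : GaugeConfig 4 L SU3) (m : ℝ) (p r : QuarkIdx L) :
    ‖(wilsonDirac (fundamentalRep (Fin 3)) U m 1)⁻¹ p r‖ =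
      ‖(WilsonDeterminant.hermitianWilsonDirac (fundamentalRep (Fin 3)) U m 1)⁻¹ p r‖ := by
  set Γ : Matrix (QuarkIdx L) (QuarkIdx L) ℂ := spinorLift gammaFive with hΓdef
  set D : Matrix (QuarkIdx L) (QuarkIdx L) ℂ := wilsonDirac (fundamentalRep (Fin 3)) U m 1 with hDdef
  have hΓΓ : Γ * Γ = 1 := spinorLift_gammaFive_mul_self
  have hH : WilsonDeterminant.hermitianWilsonDirac (fundamentalRep (Fin 3)) U m 1 = Γ * D := rfl
  have hD : D = Γ * (Γ * D) := by rw [← Matrix.mul_assoc, hΓΓ, Matrix.one_mul]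
  have hΓinv : Γ⁻¹ = Γ := Matrix.inv_eq_left_inv hΓΓ
  have hDinv : D⁻¹ = (Γ * D)⁻¹ * Γ := by
    conv_lhs => rw [hD]
    rw [Matrix.mul_inv_rev, hΓinv]
  rw [hDinv, hH, hΓdef, spinorLift_gammaFive_eq_diagonal, mul_diagonal, norm_mul, norm_gammaFiveSign,
    mul_one]

/-- **Spectral domination for the Wilson quark propagator**: for every `SU(3)` gauge field `U`, bare
mass `m`, two INJECTIVE index maps `ρ, κ` into the quark indices of one flavour and `q ≥ 1`,
`Σ_x ‖D_W(U,m)⁻¹ (ρ x) (κ x)‖^q ≤ Σ_t |λ_t|^{-q}`, `λ_t` the (real) eigenvalues of the Hermitian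
Wilson–Dirac operator `Γ₅ D_W(U, m)`. -/
theorem sum_norm_inv_wilsonDirac_rpow_le (U : GaugeConfig 4 L SU3) (m : ℝ) {ι : Type*} [Fintype ι]
    (ρ κ : ι → QuarkIdx L) (hρ : Function.Injective ρ) (hκ : Function.Injective κ) {q : ℝ} (hq : 1 ≤ q) :
    ∑ x, ‖(wilsonDirac (fundamentalRep (Fin 3)) U m 1)⁻¹ (ρ x) (κ x)‖ ^ q ≤
      ∑ t, (|(WilsonDeterminant.isHermitian_hermitianWilsonDirac (fundamentalRep (Fin 3))
        fundamentalRep_mem_unitaryGroup U m 1).eigenvalues t|⁻¹) ^ q := by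
  simp_rw [norm_inv_wilsonDirac_apply_eq]
  exact sum_norm_inv_apply_rpow_le _ ρ κ hρ hκ hq

/-- Single-entry case: `‖D_W(U,m)⁻¹ p r‖^q ≤ Σ_t |λ_t|^{-q}`. -/
theorem norm_inv_wilsonDirac_rpow_le (U : GaugeConfig 4 L SU3) (m : ℝ) (p r : QuarkIdx L) {q : ℝ}
    (hq : 1 ≤ q) :
    ‖(wilsonDirac (fundamentalRep (Fin 3)) U m 1)⁻¹ p r‖ ^ q ≤
      ∑ t, (|(WilsonDeterminant.isHermitian_hermitianWilsonDirac (fundamentalRep (Fin 3))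
        fundamentalRep_mem_unitaryGroup U m 1).eigenvalues t|⁻¹) ^ q := by
  rw [norm_inv_wilsonDirac_apply_eq]
  exact norm_inv_apply_rpow_le _ p r hq

/-- **The phase-quenched weight is the product of the same eigenvalues**: `|det D_W(U, m)| = ∏_t |λ_t|`
(so the `|det|`-tilt and the spectral bound above speak about one and the same spectrum). -/
theorem norm_det_wilsonDirac_eq_prod_abs_eigenvalues (U : GaugeConfig 4 L SU3) (m : ℝ) :
    ‖(wilsonDirac (fundamentalRep (Fin 3)) U m 1).det‖ =
      ∏ t, |(WilsonDeterminant.isHermitian_hermitianWilsonDirac (fundamentalRep (Fin 3))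
        fundamentalRep_mem_unitaryGroup U m 1).eigenvalues t| := by
  have h := WilsonDeterminant.fermionDet_wilsonDirac_eq_prod_eigenvalues (fundamentalRep (Fin 3))
    fundamentalRep_mem_unitaryGroup U m 1
  rw [fermionDet] at h
  rw [h, norm_prod]
  simp_rw [Complex.norm_real, Real.norm_eq_abs]

/-- **Translate family**: the torus translates `x ↦ ((x, c), (x + w, c'))` of one entry pattern are
injective in both slots, so `Σ_x ‖D_W⁻¹ ((x,c),(x+w,c'))‖^q ≤ Σ_t |λ_t|^{-q}`. -/
theorem sum_translates_norm_inv_wilsonDirac_rpow_le (U : GaugeConfig 4 L SU3) (m : ℝ)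
    (c c' : Fin 3 × Fin 4) (w : TorusSite 4 L) {q : ℝ} (hq : 1 ≤ q) :
    ∑ x : TorusSite 4 L, ‖(wilsonDirac (fundamentalRep (Fin 3)) U m 1)⁻¹ (x, c) (x + w, c')‖ ^ q ≤
      ∑ t, (|(WilsonDeterminant.isHermitian_hermitianWilsonDirac (fundamentalRep (Fin 3))
        fundamentalRep_mem_unitaryGroup U m 1).eigenvalues t|⁻¹) ^ q :=
  sum_norm_inv_wilsonDirac_rpow_le U m (fun x => (x, c)) (fun x => (x + w, c'))
    (fun _ _ h => (Prod.ext_iff.1 h).1) (fun _ _ h => add_right_cancel (Prod.ext_iff.1 h).1) hq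

end Wilson

/-! ## The `N_f`-flavour matrix and the phase-quenched measure -/

section PhaseQuenched

open Literature.Barriers.QuantumFields

variable {Nf L : ℕ} [NeZero L]

/-- **Same-flavour entries of `(diracMatrix U mq)⁻¹` are dominated by the one-flavour propagator**:
`‖D⁻¹((f,p),(f,r))‖ ≤ ‖D_W(U, m_f)⁻¹ p r‖` — equality where every flavour determinant is non-zero
(`inv_diracMatrix_apply_same_flavour`), and `0 ≤ ·` where some vanishes (Mathlib's `D⁻¹ = 0`). -/
theorem norm_inv_diracMatrix_apply_le_norm_inv_wilsonDirac (U : GaugeConfig 4 L SU3) (mq : Fin Nf → ℝ)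
    (f : Fin Nf) (p r : QuarkIdx L) :
    ‖(diracMatrix U mq)⁻¹ (quarkEquiv (f, p)) (quarkEquiv (f, r))‖ ≤
      ‖(wilsonDirac (fundamentalRep (Fin 3)) U (mq f) 1)⁻¹ p r‖ := by
  by_cases hdet : ∀ g, (wilsonDirac (fundamentalRep (Fin 3)) U (mq g) 1).det ≠ 0
  · rw [inv_diracMatrix_apply_same_flavour U mq hdet f p r]
  · push Not at hdet
    obtain ⟨g, hg⟩ := hdet
    have h0 : (diracMatrix U mq).det = 0 := by
      rw [det_diracMatrix]
      exact Finset.prod_eq_zero (Finset.mem_univ g) hg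
    rw [Matrix.nonsing_inv_apply_not_isUnit _ (by rw [h0]; exact not_isUnit_zero), Matrix.zero_apply,
      norm_zero]
    exact norm_nonneg _

/-- **Pointwise spectral domination of a same-flavour propagator entry** (the bound that transfers
integrability): `‖D⁻¹((f,p),(f,r))‖^q ≤ Σ_t |λ_t(Γ₅ D_W(U, m_f))|^{-q}` for `q ≥ 1`. -/
theorem norm_inv_diracMatrix_rpow_le_spectral (U : GaugeConfig 4 L SU3) (mq : Fin Nf → ℝ) (f : Fin Nf)
    (p r : QuarkIdx L) {q : ℝ} (hq : 1 ≤ q) :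
    ‖(diracMatrix U mq)⁻¹ (quarkEquiv (f, p)) (quarkEquiv (f, r))‖ ^ q ≤
      ∑ t, (|(WilsonDeterminant.isHermitian_hermitianWilsonDirac (fundamentalRep (Fin 3))
        fundamentalRep_mem_unitaryGroup U (mq f) 1).eigenvalues t|⁻¹) ^ q :=
  (Real.rpow_le_rpow (norm_nonneg _) (norm_inv_diracMatrix_apply_le_norm_inv_wilsonDirac U mq f p r)
    (by linarith)).trans (norm_inv_wilsonDirac_rpow_le U (mq f) p r hq)

/-- **Translate family of same-flavour entries**:
`Σ_x ‖D⁻¹((f,(x,c)),(f,(x+w,c')))‖^q ≤ Σ_t |λ_t(Γ₅ D_W(U, m_f))|^{-q}` for `q ≥ 1`. -/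
theorem sum_translates_norm_inv_diracMatrix_rpow_le (U : GaugeConfig 4 L SU3) (mq : Fin Nf → ℝ)
    (f : Fin Nf) (c c' : Fin 3 × Fin 4) (w : TorusSite 4 L) {q : ℝ} (hq : 1 ≤ q) :
    ∑ x : TorusSite 4 L, ‖(diracMatrix U mq)⁻¹ (quarkEquiv (f, (x, c))) (quarkEquiv (f, (x + w, c')))‖ ^ q ≤
      ∑ t, (|(WilsonDeterminant.isHermitian_hermitianWilsonDirac (fundamentalRep (Fin 3))
        fundamentalRep_mem_unitaryGroup U (mq f) 1).eigenvalues t|⁻¹) ^ q :=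
  (Finset.sum_le_sum fun x _ => Real.rpow_le_rpow (norm_nonneg _)
    (norm_inv_diracMatrix_apply_le_norm_inv_wilsonDirac U mq f (x, c) (x + w, c')) (by linarith)).trans
    (sum_translates_norm_inv_wilsonDirac_rpow_le U (mq f) c c' w hq)

/-- **The phase-quenched lattice-QCD measure is translation invariant**: it is the translation-invariant
Wilson measure (`wilsonMeasure_map_torusConfigShift`) with the translation-invariant density
`∏_f |det D_W(U, m_f)|` (`fermionDet_wilsonDirac_torusConfigShift`), up to a scalar. -/
theorem qcdLatticeMeasure_map_torusConfigShift (β : ℝ) (mq : Fin Nf → ℝ) (v : TorusSite 4 L) :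
    (qcdLatticeMeasure L β mq).map (torusConfigShift v) = qcdLatticeMeasure L β mq := by
  obtain ⟨hZ0, hZT⟩ := partitionFunction_fundamental_ne_zero_and_ne_top (S := L) β
  have hw : wilsonWeight (d := 4) (L := L) (fundamentalRep (Fin 3)) β =
      partitionFunction (d := 4) (L := L) (fundamentalRep (Fin 3)) β •
        wilsonMeasure (d := 4) (L := L) (fundamentalRep (Fin 3)) β := by
    rw [wilsonMeasure, smul_smul, ENNReal.mul_inv_cancel hZ0 hZT, one_smul]
  have hdens : ((wilsonMeasure (d := 4) (L := L) (fundamentalRep (Fin 3)) β).withDensity fun U =>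
      ENNReal.ofReal (∏ f, ‖fermionDet (wilsonDirac (fundamentalRep (Fin 3)) U (mq f) 1)‖)).map
        (torusConfigShift v) =
      (wilsonMeasure (d := 4) (L := L) (fundamentalRep (Fin 3)) β).withDensity fun U =>
        ENNReal.ofReal (∏ f, ‖fermionDet (wilsonDirac (fundamentalRep (Fin 3)) U (mq f) 1)‖) :=
    withDensity_map_of_measurableEquiv _ _ _ (wilsonMeasure_map_torusConfigShift _ β v) fun U => by
      simp_rw [fermionDet_wilsonDirac_torusConfigShift]
  rw [qcdLatticeMeasure, qcdLatticeWeight, hw, withDensity_smul_measure, Measure.map_smul, Measure.map_smul,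
    hdens]

/-- Phase-quenched integrals are invariant under translating the configuration. -/
theorem integral_qcdLatticeMeasure_comp_torusConfigShift {E : Type*} [NormedAddCommGroup E]
    [NormedSpace ℝ E] (β : ℝ) (mq : Fin Nf → ℝ) (v : TorusSite 4 L) (g : GaugeConfig 4 L SU3 → E) :
    ∫ U, g (torusConfigShift v U) ∂(qcdLatticeMeasure L β mq) = ∫ U, g U ∂(qcdLatticeMeasure L β mq) := by
  rw [← integral_map_equiv, qcdLatticeMeasure_map_torusConfigShift]

/-- **Phase-quenched moments of propagator entries do not see where the entry sits**: the law of
`‖D⁻¹((f,(x,c)),(f,(x+w,c')))‖^q` under `qcdLatticeMeasure` is that of the entry at `x = 0` (translation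
covariance of `D⁻¹`, `inv_diracMatrix_torusConfigShift_apply`, and invariance of the measure). -/
theorem integral_norm_inv_diracMatrix_rpow_translate (β : ℝ) (mq : Fin Nf → ℝ) (f : Fin Nf)
    (c c' : Fin 3 × Fin 4) (w x : TorusSite 4 L) (q : ℝ) :
    ∫ U, ‖(diracMatrix U mq)⁻¹ (quarkEquiv (f, (x, c))) (quarkEquiv (f, (x + w, c')))‖ ^ q
        ∂(qcdLatticeMeasure L β mq) =
      ∫ U, ‖(diracMatrix U mq)⁻¹ (quarkEquiv (f, ((0 : TorusSite 4 L), c))) (quarkEquiv (f, (w, c')))‖ ^ q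
        ∂(qcdLatticeMeasure L β mq) := by
  rw [← integral_qcdLatticeMeasure_comp_torusConfigShift β mq (-x)
    (fun U => ‖(diracMatrix U mq)⁻¹ (quarkEquiv (f, ((0 : TorusSite 4 L), c))) (quarkEquiv (f, (w, c')))‖ ^ q)]
  simp only [inv_diracMatrix_torusConfigShift_apply, sub_neg_eq_add, zero_add, add_comm w x]

/-- **SPECTRAL REDUCTION OF THE `r = 1` SLICE OF THE CORE.**  If `T(U) = Σ_t |λ_t(Γ₅ D_W(U, m_f))|^{-q}` is
phase-quenched integrable then so is the `q`-th power of every same-flavour entry, and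
`#sites · ⟨‖G_f((0,c),(w,c'))‖^q⟩₊ ≤ ⟨T⟩₊`: a volume- and `k`-uniform bound on the `|det|`-tilted density of
states `⟨(12·#sites)⁻¹ Σ_t |λ_t|^{-(1+ε)}⟩₊ ≤ C` gives `MinorMoments` at `r = 1` with constant `12 C`. -/
theorem card_mul_phaseQuenched_entry_rpow_le (β : ℝ) (mq : Fin Nf → ℝ) (f : Fin Nf) (c c' : Fin 3 × Fin 4)
    (w : TorusSite 4 L) {q : ℝ} (hq : 1 ≤ q)
    (hT : Integrable (fun U : GaugeConfig 4 L SU3 =>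
      ∑ t, (|(WilsonDeterminant.isHermitian_hermitianWilsonDirac (fundamentalRep (Fin 3))
        fundamentalRep_mem_unitaryGroup U (mq f) 1).eigenvalues t|⁻¹) ^ q) (qcdLatticeMeasure L β mq)) :
    Integrable (fun U : GaugeConfig 4 L SU3 =>
        ‖(diracMatrix U mq)⁻¹ (quarkEquiv (f, ((0 : TorusSite 4 L), c))) (quarkEquiv (f, (w, c')))‖ ^ q)
        (qcdLatticeMeasure L β mq) ∧
      (Fintype.card (TorusSite 4 L) : ℝ) *
          qcdPhaseQuenchedExpect β L mq (fun U : GaugeConfig 4 L SU3 =>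
            ‖(diracMatrix U mq)⁻¹ (quarkEquiv (f, ((0 : TorusSite 4 L), c))) (quarkEquiv (f, (w, c')))‖ ^ q) ≤
        qcdPhaseQuenchedExpect β L mq (fun U : GaugeConfig 4 L SU3 =>
          ∑ t, (|(WilsonDeterminant.isHermitian_hermitianWilsonDirac (fundamentalRep (Fin 3))
            fundamentalRep_mem_unitaryGroup U (mq f) 1).eigenvalues t|⁻¹) ^ q) := by
  -- every translate of the entry is dominated by `T`, hence integrable
  have hmeas : ∀ x : TorusSite 4 L, Measurable fun U : GaugeConfig 4 L SU3 =>
      ‖(diracMatrix U mq)⁻¹ (quarkEquiv (f, (x, c))) (quarkEquiv (f, (x + w, c')))‖ ^ q := fun x =>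
    (measurable_inv_diracMatrix_apply mq _ _).norm.pow_const q
  have hint : ∀ x : TorusSite 4 L, Integrable (fun U : GaugeConfig 4 L SU3 =>
      ‖(diracMatrix U mq)⁻¹ (quarkEquiv (f, (x, c))) (quarkEquiv (f, (x + w, c')))‖ ^ q)
      (qcdLatticeMeasure L β mq) := fun x =>
    hT.mono' (hmeas x).aestronglyMeasurable (Eventually.of_forall fun U => by
      rw [Real.norm_eq_abs, abs_of_nonneg (Real.rpow_nonneg (norm_nonneg _) q)]
      exact norm_inv_diracMatrix_rpow_le_spectral U mq f _ _ hq)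
  have h0 := hint 0
  simp only [zero_add] at h0
  refine ⟨h0, ?_⟩
  rw [qcdPhaseQuenchedExpect_eq_integral_qcdLatticeMeasure, qcdPhaseQuenchedExpect_eq_integral_qcdLatticeMeasure]
  calc (Fintype.card (TorusSite 4 L) : ℝ) *
        ∫ U, ‖(diracMatrix U mq)⁻¹ (quarkEquiv (f, ((0 : TorusSite 4 L), c))) (quarkEquiv (f, (w, c')))‖ ^ q
          ∂(qcdLatticeMeasure L β mq)
      = ∑ x : TorusSite 4 L,
          ∫ U, ‖(diracMatrix U mq)⁻¹ (quarkEquiv (f, (x, c))) (quarkEquiv (f, (x + w, c')))‖ ^ q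
            ∂(qcdLatticeMeasure L β mq) := by
        simp_rw [integral_norm_inv_diracMatrix_rpow_translate]
        rw [Finset.sum_const, Finset.card_univ, nsmul_eq_mul]
    _ = ∫ U, ∑ x : TorusSite 4 L,
          ‖(diracMatrix U mq)⁻¹ (quarkEquiv (f, (x, c))) (quarkEquiv (f, (x + w, c')))‖ ^ q
            ∂(qcdLatticeMeasure L β mq) := (integral_finsetSum _ fun x _ => hint x).symm
    _ ≤ ∫ U, ∑ t, (|(WilsonDeterminant.isHermitian_hermitianWilsonDirac (fundamentalRep (Fin 3))
            fundamentalRep_mem_unitaryGroup U (mq f) 1).eigenvalues t|⁻¹) ^ q ∂(qcdLatticeMeasure L β mq) :=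
        integral_mono (integrable_finsetSum _ fun x _ => hint x) hT fun U =>
          sum_translates_norm_inv_diracMatrix_rpow_le U mq f c c' w hq

/-- **Registered stub `stub_spectralReductionR1`** of crux stmt-QuantumFields-9151 (line
`crossing-split-integrability`, lead c3): the spectral reduction of the `r = 1` slice of the open core, in
closed form — for every flavour number, torus, coupling, bare-mass tuple, flavour `f`, colour–spin pair,
displacement `w` and exponent `q ≥ 1`, phase-quenched integrability of `Σ_t |λ_t(Γ₅ D_W(U, m_f))|^{-q}`
implies phase-quenched integrability of `‖G_f((0,c),(w,c'))‖^q` and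
`#sites · ⟨‖G_f((0,c),(w,c'))‖^q⟩₊ ≤ ⟨Σ_t |λ_t|^{-q}⟩₊`. -/
theorem stub_spectralReductionR1 :
    ∀ (Nf L : ℕ) [NeZero L] (β : ℝ) (mq : Fin Nf → ℝ) (f : Fin Nf) (c c' : Fin 3 × Fin 4) (w : TorusSite 4 L)
      (q : ℝ), 1 ≤ q →
      Integrable (fun U : GaugeConfig 4 L SU3 =>
        ∑ t, (|(Literature.Barriers.QuantumFields.WilsonDeterminant.isHermitian_hermitianWilsonDirac
          (fundamentalRep (Fin 3)) fundamentalRep_mem_unitaryGroup U (mq f) 1).eigenvalues t|⁻¹) ^ q)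
        (qcdLatticeMeasure L β mq) →
      Integrable (fun U : GaugeConfig 4 L SU3 =>
          ‖(diracMatrix U mq)⁻¹ (quarkEquiv (f, ((0 : TorusSite 4 L), c))) (quarkEquiv (f, (w, c')))‖ ^ q)
          (qcdLatticeMeasure L β mq) ∧
        (Fintype.card (TorusSite 4 L) : ℝ) *
            qcdPhaseQuenchedExpect β L mq (fun U : GaugeConfig 4 L SU3 =>
              ‖(diracMatrix U mq)⁻¹ (quarkEquiv (f, ((0 : TorusSite 4 L), c))) (quarkEquiv (f, (w, c')))‖ ^ q) ≤
          qcdPhaseQuenchedExpect β L mq (fun U : GaugeConfig 4 L SU3 =>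
            ∑ t, (|(Literature.Barriers.QuantumFields.WilsonDeterminant.isHermitian_hermitianWilsonDirac
              (fundamentalRep (Fin 3)) fundamentalRep_mem_unitaryGroup U (mq f) 1).eigenvalues t|⁻¹) ^ q) :=
  fun _ _ _ β mq f c c' w _ hq hT => card_mul_phaseQuenched_entry_rpow_le β mq f c c' w hq hT

end PhaseQuenched

end Summit.QuantumFields.QCD.Cruxes.PhaseQuenchedFlavourDecay.CrossingSplitIntegrability

end
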